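import Summits.ResolutionOfSingularities.ResolutionOfSingularities.Theorems.HilbertSamuelEliminationSigmaMaxModificationsCorridor3SigmaTameLowSncBranchChart
import Literature.AlgebraicGeometry.Resolution.QuadraticTransformsStructure
import HarnessLib

/-!
# [OURS · L1 W4.2] TAME-LOW row T-L4 «SNC PHASE, lineage-local» — part 4b (singular-branch half): the branch map at a point of the
# blow-up — for a quadratic transform `R₁` of `R` through which the strict transform `f₁ = f/xᵐ` of the branch `V(f)` passes, the point
# `θ : R → L` of the branch extends to `ψ : R₁ → L` with `ker ψ = (f₁)`
# (cell res-hironaka, LADDER-RESOLUTION rung L; slot W4.2, crux chain w42 `SigmaMaxModificationsCorridor3` stmt-ResolutionOfSingularities-19249 /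
# crux `SigmaMaxModifications` stmt-…-18506; res-L1-w42-plan-1 RULING v3.14-48 (PD)(iv)/(PF) row T-L4 → res-L1-w42-stub-4 (gen 7);
# `--supports stmt-ResolutionOfSingularities-19249 --as helper`; consumer: part 4c (`ψ(R₁)` is a quadratic transform of `θ(R)`, `δ` drops))

HONEST FRAMING.  OURS bookkeeping for the TAME-LOW tier (RULING v3.14-48 (PD)(iv)): Herrmann–Ikeda–Orbanz Thm. (30.2) (b) «`R⁽¹⁾/𝔭⁽¹⁾` is a
quadratic transform of `R/𝔭`», first half — the ring map — in the `Subring K` currency. Nothing here is a statement of H. Hironaka's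
manuscript [Hironaka2017] (CANDIDATE, never a premise) nor of Cossart–Jannsen–Saito; no named fact; every theorem PROVED. AI-written;
weaker than expert review.

SETTING.  `R ⊆ R₁ ⊆ K`, `R` two-dimensional regular local with `𝔪_R = (x, y)`, `R₁` a quadratic transform of `R` in the chart of `x`
(`R[𝔪/x] = R[y/x] ⊆ R₁`); a field `L` and `θ : R → L` with `ker θ = (f)`, `f ∈ 𝔪ᵐ ∖ 𝔪ᵐ⁺¹` (so `θ x ≠ 0` iff `f ∤ x`, automatic for
`m ≥ 2` or `f` not associated to `x`); the strict transform `f₁ = f/xᵐ ∈ R₁` is assumed to lie in `𝔪_{R₁}` (the blown-up branch passes through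
the point `R₁`).

* `branchLift` `ψ : R₁ →+* L` — the extension of `chartLift θ : R[y/x] → L` through the localisation `R₁ = R[y/x]_Q` (`Q = 𝔪_{R₁} ∩ R[y/x]`;
  elements of `R[y/x] ∖ Q` have non-zero image since `ker (chartLift θ) = (f₁) ⊆ Q`); `branchLift_inclusion : ψ r = θ r`,
  `branchLift_mul_eq` (`ψ(z) · chartLift s = chartLift a` for `z = a/s`), `branchLift_of_mem_chart`.
* **`ker_branchLift`** — `ker ψ = f₁ R₁`; hence `f₁ R₁` is a prime ideal (`isPrime_span_strictTransform`: the strict transform of a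
  branch is again a branch — a prime — at every point it passes through).
* `mem_maximalIdeal_range_iff` — for `r ∈ R`: `θ r` is a non-unit of `θ(R)` iff `r ∈ 𝔪_R` (as `ker θ ⊆ 𝔪_R`).

References: M. Herrmann, S. Ikeda, U. Orbanz (1988), Thm. (30.2) and Ch. II [HerrmannIkedaOrbanz1988]; C. Huneke, I. Swanson (2006), §14.2
and proof of Thm. 14.5.2 [HunekeSwanson2006].
-/

noncomputable section

set_option linter.dupNamespace false -- mandated namespace of this single-conjunct summit

open IsLocalRing Polynomial Literature.AlgebraicGeometry.Resolution

namespace Summit.ResolutionOfSingularities.ResolutionOfSingularities.Theorems.SigmaMaxModificationsCorridor3.TameLowSnc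

universe u v

variable {K : Type u} [Field K]

section Branch

variable {R R₁ : Subring K} [IsRegularLocalRing R] [IsLocalRing R₁] {x y : R} {L : Type v} [Field L]

omit [IsLocalRing R₁] in
/-- The chart `R[y/x]` lies in a quadratic transform in the chart of `x`. [OURS · proved] -/
theorem chartAdjoin_le (hm : maximalIdeal R = Ideal.span {x, y}) (hT : blowupRing R (x : K) ≤ R₁) :
    chartAdjoin (K := K) x y ≤ R₁ :=
  (blowupRing_eq_adjoin (K := K) hm).ge.trans hT

/-- The data of the branch map: hypotheses bundled as a structure-free predicate would obscure the statement; we keep them explicit.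
For `s ∈ R[y/x]` outside `Q = 𝔪_{R₁} ∩ R[y/x]`, `chartLift θ s ≠ 0` — because `ker (chartLift θ) = (f₁) ⊆ Q`. [OURS · proved] -/
theorem isUnit_chartLift_of_not_mem (hdim : ringKrullDim R = 2) (hm : maximalIdeal R = Ideal.span {x, y})
    (hT : blowupRing R (x : K) ≤ R₁) (θ : R →+* L) (hθx : θ x ≠ 0) {f : R} (hker : RingHom.ker θ = Ideal.span {f}) {m : ℕ}
    (hf : f ∈ maximalIdeal R ^ m) (hf' : f ∉ maximalIdeal R ^ (m + 1))
    (hf₁ : (⟨_, chartAdjoin_le hm hT (div_pow_mem_chartAdjoin hm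
      (fun h => fst_not_mem_sq hdim hm (h ▸ Ideal.zero_mem _)) hf)⟩ : R₁) ∈ maximalIdeal R₁)
    (s : ((maximalIdeal R₁).comap (Subring.inclusion (chartAdjoin_le (K := K) hm hT))).primeCompl) :
    IsUnit (chartLift (K := K) (fun h => fst_not_mem_sq hdim hm (h ▸ Ideal.zero_mem _)) θ hθx
      (s : chartAdjoin (K := K) x y)) := by
  rw [isUnit_iff_ne_zero]
  intro hs
  have hmem : (s : chartAdjoin (K := K) x y) ∈
      RingHom.ker (chartLift (K := K) (fun h => fst_not_mem_sq hdim hm (h ▸ Ideal.zero_mem _)) θ hθx) := hs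
  rw [ker_chartLift hdim hm θ hθx hker hf hf', Ideal.mem_span_singleton'] at hmem
  obtain ⟨c, hc⟩ := hmem
  have hsQ : (s : chartAdjoin (K := K) x y) ∈ (maximalIdeal R₁).comap (Subring.inclusion (chartAdjoin_le hm hT)) := by
    rw [Ideal.mem_comap, ← hc, map_mul]
    exact Ideal.mul_mem_left _ _ hf₁
  exact s.2 hsQ

/-- **The branch map `ψ : R₁ → L`** at a point `R₁` of the blow-up through which the strict transform of the branch passes: the
localisation of `chartLift θ` (`R₁ = R[y/x]_Q` by the chart change `IsQuadraticTransform.eq_ofPrime_of_le`).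
[OURS · L1 W4.2 bookkeeping; Herrmann–Ikeda–Orbanz Thm. (30.2)] -/
def branchLift (hdim : ringKrullDim R = 2) (hm : maximalIdeal R = Ideal.span {x, y}) (hq : IsQuadraticTransform R R₁)
    (hT : blowupRing R (x : K) ≤ R₁) (θ : R →+* L) (hθx : θ x ≠ 0) {f : R} (hker : RingHom.ker θ = Ideal.span {f}) {m : ℕ}
    (hf : f ∈ maximalIdeal R ^ m) (hf' : f ∉ maximalIdeal R ^ (m + 1))
    (hf₁ : (⟨_, chartAdjoin_le hm hT (div_pow_mem_chartAdjoin hm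
      (fun h => fst_not_mem_sq hdim hm (h ▸ Ideal.zero_mem _)) hf)⟩ : R₁) ∈ maximalIdeal R₁) : R₁ →+* L :=
  (IsLocalization.lift (M := ((maximalIdeal R₁).comap (Subring.inclusion (chartAdjoin_le (K := K) hm hT))).primeCompl)
      (S := (LocalSubring.ofPrime (chartAdjoin (K := K) x y)
        ((maximalIdeal R₁).comap (Subring.inclusion (chartAdjoin_le (K := K) hm hT)))).toSubring)
      (isUnit_chartLift_of_not_mem hdim hm hT θ hθx hker hf hf' hf₁)).comp
    (Subring.inclusion (hq.eq_ofPrime_of_le (hm ▸ Ideal.subset_span (by simp))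
      (fun h => fst_not_mem_sq hdim hm (h ▸ Ideal.zero_mem _)) (blowupRing_eq_adjoin (K := K) hm).le
      (chartAdjoin_le hm hT)).le)

section API

variable (hdim : ringKrullDim R = 2) (hm : maximalIdeal R = Ideal.span {x, y}) (hq : IsQuadraticTransform R R₁)
  (hT : blowupRing R (x : K) ≤ R₁) (θ : R →+* L) (hθx : θ x ≠ 0) {f : R} (hker : RingHom.ker θ = Ideal.span {f}) {m : ℕ}
  (hf : f ∈ maximalIdeal R ^ m) (hf' : f ∉ maximalIdeal R ^ (m + 1))
  (hf₁ : (⟨_, chartAdjoin_le hm hT (div_pow_mem_chartAdjoin hm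
    (fun h => fst_not_mem_sq hdim hm (h ▸ Ideal.zero_mem _)) hf)⟩ : R₁) ∈ maximalIdeal R₁)

/-- `ψ` extends the chart map: `ψ a = chartLift θ a` for `a ∈ R[y/x]`. [OURS · proved] -/
theorem branchLift_of_mem_chart (a : chartAdjoin (K := K) x y) :
    branchLift hdim hm hq hT θ hθx hker hf hf' hf₁ ⟨(a : K), chartAdjoin_le hm hT a.2⟩ =
      chartLift (K := K) (fun h => fst_not_mem_sq hdim hm (h ▸ Ideal.zero_mem _)) θ hθx a := by
  unfold branchLift
  rw [RingHom.comp_apply]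
  have e : Subring.inclusion (hq.eq_ofPrime_of_le (hm ▸ Ideal.subset_span (by simp))
      (fun h => fst_not_mem_sq hdim hm (h ▸ Ideal.zero_mem _)) (blowupRing_eq_adjoin (K := K) hm).le
      (chartAdjoin_le hm hT)).le ⟨(a : K), chartAdjoin_le hm hT a.2⟩ =
      algebraMap (chartAdjoin (K := K) x y) _ a := Subtype.ext rfl
  rw [e, IsLocalization.lift_eq]

/-- `ψ` extends `θ`: `ψ r = θ r` for `r ∈ R`. [OURS · proved] -/
theorem branchLift_inclusion (r : R) :
    branchLift hdim hm hq hT θ hθx hker hf hf' hf₁ (Subring.inclusion hq.dominates.1 r) = θ r := by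
  have e : Subring.inclusion hq.dominates.1 r = ⟨((chartIncl (K := K) x y r : chartAdjoin x y) : K),
      chartAdjoin_le hm hT (chartIncl x y r).2⟩ := Subtype.ext rfl
  rw [e, branchLift_of_mem_chart, chartLift_chartIncl]

/-- `ψ` on a fraction: for `z ∈ R₁` with `z · s = a` (`a, s ∈ R[y/x]`), `ψ z · chartLift s = chartLift a`. [OURS · proved] -/
theorem branchLift_mul_eq {z : R₁} {a s : chartAdjoin (K := K) x y} (hzs : (z : K) * (s : K) = (a : K)) :
    branchLift hdim hm hq hT θ hθx hker hf hf' hf₁ z *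
      chartLift (K := K) (fun h => fst_not_mem_sq hdim hm (h ▸ Ideal.zero_mem _)) θ hθx s =
      chartLift (K := K) (fun h => fst_not_mem_sq hdim hm (h ▸ Ideal.zero_mem _)) θ hθx a := by
  rw [← branchLift_of_mem_chart hdim hm hq hT θ hθx hker hf hf' hf₁ s,
    ← branchLift_of_mem_chart hdim hm hq hT θ hθx hker hf hf' hf₁ a, ← map_mul]
  congr 1
  exact Subtype.ext hzs

/-- **`ker ψ = f₁ R₁`**: the strict transform cuts out the branch at `R₁`. [OURS · proved; Herrmann–Ikeda–Orbanz Thm. (30.2)] -/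
theorem ker_branchLift :
    RingHom.ker (branchLift hdim hm hq hT θ hθx hker hf hf' hf₁) =
      Ideal.span {(⟨_, chartAdjoin_le hm hT (div_pow_mem_chartAdjoin hm
        (fun h => fst_not_mem_sq hdim hm (h ▸ Ideal.zero_mem _)) hf)⟩ : R₁)} := by
  have hx0 : x ≠ 0 := fun h => fst_not_mem_sq hdim hm (h ▸ Ideal.zero_mem _)
  have hx : x ∈ maximalIdeal R := hm ▸ Ideal.subset_span (by simp)
  have hAle := chartAdjoin_le (K := K) hm hT
  set Q : Ideal (chartAdjoin (K := K) x y) := (maximalIdeal R₁).comap (Subring.inclusion hAle) with hQ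
  have hR₁ : R₁ = (LocalSubring.ofPrime _ Q).toSubring :=
    hq.eq_ofPrime_of_le hx hx0 (blowupRing_eq_adjoin (K := K) hm).le hAle
  set f₁ : chartAdjoin (K := K) x y := ⟨_, div_pow_mem_chartAdjoin hm hx0 hf⟩ with hf₁def
  apply le_antisymm
  · intro z hz
    rw [RingHom.mem_ker] at hz
    obtain ⟨a, s, hs, hzas⟩ := mem_ofPrime_iff.mp (hR₁.le z.2)
    have hs0 : ((s : chartAdjoin (K := K) x y) : K) ≠ 0 := coe_ne_zero_of_not_mem hs
    have hzs : (z : K) * (s : K) = (a : K) := by rw [hzas, div_mul_cancel₀ _ hs0]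
    have h := branchLift_mul_eq hdim hm hq hT θ hθx hker hf hf' hf₁ hzs
    rw [hz, zero_mul] at h
    have ha : a ∈ RingHom.ker (chartLift (K := K) hx0 θ hθx) := h.symm
    rw [ker_chartLift hdim hm θ hθx hker hf hf', Ideal.mem_span_singleton'] at ha
    obtain ⟨c, hc⟩ := ha
    -- `z = a/s = f₁ · (c/s)`
    have hsR₁ : ((s : chartAdjoin (K := K) x y) : K) ∈ R₁ := hAle s.2
    have hsunit : IsUnit (⟨(s : K), hsR₁⟩ : R₁) := by
      by_contra hns
      exact hs ((mem_maximalIdeal _).mpr hns)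
    obtain ⟨w, hw⟩ := hsunit
    rw [Ideal.mem_span_singleton']
    refine ⟨⟨(c : K), hAle c.2⟩ * ↑w⁻¹, ?_⟩
    have hzw : z * (w : R₁) = ⟨(c : K), hAle c.2⟩ * ⟨(f₁ : K), hAle f₁.2⟩ := by
      rw [hw]
      apply Subtype.ext
      change (z : K) * (s : K) = (c : K) * (f₁ : K)
      rw [hzs, ← hc, Subring.coe_mul]
    calc ⟨(c : K), hAle c.2⟩ * ↑w⁻¹ * (⟨_, hAle f₁.2⟩ : R₁)
        = (⟨(c : K), hAle c.2⟩ * ⟨(f₁ : K), hAle f₁.2⟩) * ↑w⁻¹ := by ring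
      _ = z * (w : R₁) * ↑w⁻¹ := by rw [hzw]
      _ = z := by rw [mul_assoc, Units.mul_inv, mul_one]
  · rw [Ideal.span_singleton_le_iff_mem, RingHom.mem_ker]
    have e : (⟨_, hAle (div_pow_mem_chartAdjoin hm hx0 hf)⟩ : R₁) = ⟨(f₁ : K), hAle f₁.2⟩ := rfl
    rw [e, branchLift_of_mem_chart]
    have : f₁ ∈ RingHom.ker (chartLift (K := K) hx0 θ hθx) := by
      rw [ker_chartLift hdim hm θ hθx hker hf hf']; exact Ideal.mem_span_singleton_self _
    exact this

include hq θ hθx hker hf' hf₁ in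
/-- The strict transform generates a PRIME ideal of `R₁` (the quotient embeds into the field `L`). [OURS · proved] -/
theorem isPrime_span_strictTransform :
    (Ideal.span {(⟨_, chartAdjoin_le hm hT (div_pow_mem_chartAdjoin hm
        (fun h => fst_not_mem_sq hdim hm (h ▸ Ideal.zero_mem _)) hf)⟩ : R₁)}).IsPrime := by
  rw [← ker_branchLift hdim hm hq hT θ hθx hker hf hf' hf₁]
  exact RingHom.ker_isPrime _

end API

omit [IsLocalRing R₁] in
/-- For `r ∈ R`: `θ r` is a non-unit of the local ring `θ(R)` iff `r ∈ 𝔪_R` (`ker θ = (f) ⊆ 𝔪_R`). [OURS · proved] -/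
theorem isUnit_rangeRestrict_iff (θ : R →+* L) {f : R} (hker : RingHom.ker θ = Ideal.span {f}) (hfm : f ∈ maximalIdeal R)
    (r : R) : IsUnit (θ.rangeRestrict r) ↔ IsUnit r := by
  constructor
  · rintro ⟨w, hw⟩
    obtain ⟨r', hr'⟩ := θ.rangeRestrict_surjective (↑w⁻¹ : θ.range)
    -- `θ (r r') = 1`, so `r r' - 1 ∈ (f) ⊆ 𝔪`, hence `r r'` is a unit
    have h1 : θ.rangeRestrict (r * r') = 1 := by rw [map_mul, hr', ← hw, Units.mul_inv]
    have h2 : r * r' - 1 ∈ RingHom.ker θ := by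
      rw [RingHom.mem_ker, map_sub, map_one, sub_eq_zero]
      have := congrArg (fun t : θ.range => (t : L)) h1
      exact this
    rw [hker] at h2
    have h3 : r * r' - 1 ∈ maximalIdeal R := (Ideal.span_singleton_le_iff_mem _ |>.mpr hfm) h2
    have h4 : IsUnit (r * r') := by
      by_contra hnu
      have := Ideal.sub_mem _ ((mem_maximalIdeal _).mpr hnu) h3
      rw [sub_sub_cancel] at this
      exact (maximalIdeal.isMaximal R).ne_top (Ideal.eq_top_of_isUnit_mem _ this isUnit_one)
    exact isUnit_of_mul_isUnit_left h4
  · intro h; exact h.map _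

end Branch

end Summit.ResolutionOfSingularities.ResolutionOfSingularities.Theorems.SigmaMaxModificationsCorridor3.TameLowSnc

end
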